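import Summits.QuantumFields.YangMills.Theorems.BalabanUVNodesN15TwoSpacingGluingCurvedKnitSmallFieldNode
import Summits.QuantumFields.YangMills.Theorems.BalabanUVNodesN15TwoSpacingGluingCurvedKnitSmallFieldLaplacianDefect
import HarnessLib

/-!
# THE GLUING STEP AT TWO LATTICE SPACINGS — (Λ2f) `NE2PlusOperator` BY NAME FOR THE LIVE-BACKGROUND GLUED FAMILY WITH ENTRIES 0 AND 3 CONSTRUCTED: the propagator entry (FILE 130) and the
# Laplacian entry (FILE 134, through `Δ_UG = 1 − N_LG`); the two GRADIENT entries displayed (dag-n15-c g16, FILE 135; N15 = NE2, s1 «background-layer OPERATOR ingredient»)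

Cell `pub-ymgap`, seat `pub-ymgap-dag-n15-c` (R134 (a); HUMAN RULING D-0062), generation 16.  `bears_on: R4∕N15 · K3⁸ SpineGivenEndpointR13SepCoPHV (stmt-QuantumFields-27366)`.
Filed `--kind proof --supports stmt-QuantumFields-27366 --as helper` — COUNT-NEUTRAL.  Theorems only; 0 `def`, 0 `sorry`.  Imports BY NAME FILE 132 `…SmallFieldNode` (`ne2PlusOperator_sf`, `sfGeo_len`,
`sfGeo_rateFactor`, `sfGeo_dist_nonneg`, `hasMaj_unitTorusGeoS`) and FILE 134 `…SmallFieldLaplacianDefect` (`sf_idef_lap_cvGlued`).  Nothing in the tree is modified.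

WHAT.  ★★★ `ne2PlusOperator_sf₃` — `T4EtaRate.NE2PlusOperator c₃₅ (sfInstance d mm ι hL) (fun i => sfFamily d mm ι a e hL i (E i))` for ANY entries `E` whose entry 3 IS the Laplacian-entry
η-defect operator `𝔇_π̂(Δ′_{U′}G′, Δ_UG)` of the live pair (hypothesis `hE3`, an equation) and whose entries 1–2 (the GRADIENT entries `∇_UG`, `G∇*_U` — genuine regularity estimates of the
live glued operator, not in the tree) obey the (3.42)-shaped block majorant under the class with uniform constants (DISPLAYED): FILE 132's theorem fed with the merged rows — entry 3 from
FILE 134 at rate `min(γ₁, 1∕16)`, decay `min(δ₁, ρ)`, the window closed through the LIVE guard `M₅ ≤ M = L^m` exactly as for entry 0.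

HONEST FRAMING ∕ LIMITS.  By-name readout of a MODEL family (global small-field gauge; covariant Laplacian (3.50) ⊗ colour + FLAT nonlocal part (1.69) — NOT Bałaban's `Δ_a(U)` (3.26); C²
window incl. all mixed second differences; King-block-mean pairing; MODEL carriers; crude constants); entries 1–2 NOT produced (2 of the 4 entries of (3.42) constructed and proved); the
η-rate inequality is NOT PRINTED ([B9] Thm 3.14 = domain differences); nothing of [B5]∕[B6]∕[B9] asserted.  NE2⁺ NOT PRINTED, NOT proved; N15 NOT discharged; K3⁸ OPEN, skeleton v6 untouched
(0∕2); counts of record UNMOVED (typed 28∕28 · discharged 5∕27 · A 5∕28); one finite 𝕋⁴ at fixed ε — NOT infinite volume, NOT OS on ℝ⁴, NOT a mass gap, NOT Clay; R4 closes the conditional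
finite-𝕋⁴ rung `BalabanLadder.UV` only.  Restate-immune (no Theses import).
-/

noncomputable section

open scoped BigOperators Matrix Matrix.Norms.Frobenius

namespace Summit.QuantumFields.YangMills.BalabanUVNodes.N15.Gluing

open Literature.MathematicalPhysics.QuantumFieldTheory.Balaban1983to89
open Literature.MathematicalPhysics.QuantumFieldTheory.Balaban1983to89.B11SectG (BlockNorm HasMaj)
open Literature.MathematicalPhysics.QuantumFieldTheory.Balaban1983to89.T4EtaRate (NE2PlusOperator rateFactor)
open Literature.MathematicalPhysics.QuantumFieldTheory.Balaban1983to89.T4EtaRateDefect (idef)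
open Literature.MathematicalPhysics.QuantumFieldTheory.Balaban1983to89.T4EtaRateCoeffDefect (pull)
open Literature.MathematicalPhysics.QuantumFieldTheory.Balaban1983to89.B6UnitTorusCarrier (unitTorusGeo)
open Literature.Barriers.QuantumFields (traceForm)
open Summit.QuantumFields.YangMills.BalabanUVNodes.N15.BackgroundLayer (covLapM gavgM)
open Summit.QuantumFields.YangMills.BalabanUVNodes.N15.VectorPiece (bshiftEquiv kingPrV)
open Summit.QuantumFields.YangMills.BalabanUVNodes.N15.MatrixSpecies (coordMat liftBlk liftMap basisConst basisConst_nonneg)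
open Summit.QuantumFields.YangMills.BalabanUVNodes.N15.OperatorReadout (opGeo opGeo_len pref4_pos)
open Summit.QuantumFields.YangMills.BalabanUVNodes.N15.CurvedSpecies (gaugePair)

variable (d : ℕ) {L : ℕ} [NeZero L] (mm ι : Type) [Fintype mm] [DecidableEq mm] [Fintype ι] [DecidableEq ι] (e : Matrix mm mm ℂ ≃L[ℝ] (ι → ℝ))

set_option maxHeartbeats 800000 in
/-- ★★★ **NE2⁺, OPERATOR LAYER, BY NAME, FOR THE LIVE-BACKGROUND GLUED FAMILY — ENTRIES 0 (PROPAGATOR) AND 3 (LAPLACIAN) CONSTRUCTED AND PROVED, ENTRIES 1–2 (GRADIENTS) DISPLAYED,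
`M = L^m` LIVE.**  For odd `L ≥ 7`, `a > 0`, `c₃₅ > 0`, trace-form-orthonormal `e`: if the consumer's entry 3 is the η-defect `𝔇_π̂(Δ′_{U′}G′, Δ_UG)` of the live pair (`hE3`) and its entries 1–2 obey,
for `M₁ ≤ L^m`, `0 < α₀`, `L^mα₀ ≤ a₁` and every `A′` in the class, the (3.42)-shaped majorant with uniform `M₁, δ₁, a₁, B₁, γ₁ > 0`, then
`NE2PlusOperator c₃₅ (sfInstance d mm ι hL) (fun i => sfFamily d mm ι a e hL i (E i))`.  MODEL family; NOT [B9] Thm 3.1∕3.14 as printed.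
[cite: Balaban1985BackgroundPropagators, Thm 3.1 p.397 (quantifier template, (3.42)), Thm 3.14 pp.426–427 (difference template), (3.35)–(3.36) p.396; King1986, Prop. 3.9 (3.73) p.665 (rate factor); Balaban1984PropagatorsII, (2.91)–(2.93) p.239] -/
theorem ne2PlusOperator_sf₃ (hL : Odd L ∧ 1 < L) (hL7 : 7 ≤ L) {a : ℝ} (ha : 0 < a) {c35 : ℝ} (hc35 : 0 < c35) (he : ∀ A B : Matrix mm mm ℂ, traceForm A B = e A ⬝ᵥ e B)
    (E : ∀ i : SfIdx d L, Fin 4 → (Fin (d + 1) → CvX' d L i.m i.kk i.r hL → Matrix mm mm ℂ) → ((CvX d L i.m i.kk hL × ι → ℝ) →ₗ[ℝ] (CvX' d L i.m i.kk i.r hL × ι → ℝ)))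
    (hE3 : ∀ (i : SfIdx d L) (A' : Fin (d + 1) → CvX' d L i.m i.kk i.r hL → Matrix mm mm ℂ), E i 3 A' =
      idef (pull (liftMap (kingPrV L i.kk i.r (cvM d L i.m i.kk hL)) ι)) (pull (liftMap (kingPrV L i.kk i.r (cvM d L i.m i.kk hL)) ι)) ((covLapM (bshiftEquiv (cvM d L i.m i.kk hL) (L ^ i.r * L ^ i.kk)) ((((L ^ i.r * L ^ i.kk : ℕ) : ℝ))⁻¹) (gaugePair (bshiftEquiv (cvM d L i.m i.kk hL) (L ^ i.r * L ^ i.kk)) (fun μ x' => coordMat e (ContinuousLinearMap.mulLeftRight ℝ (Matrix mm mm ℂ) (NormedSpace.exp (((((L ^ i.r * L ^ i.kk : ℕ) : ℝ))⁻¹) • A' μ x')) (NormedSpace.exp (((((L ^ i.r * L ^ i.kk : ℕ) : ℝ))⁻¹) • A' μ x'))ᴴ)))) ∘ₗ (cvGlued' d L i.m i.kk i.r hL a ((((L ^ i.r * L ^ i.kk : ℕ) : ℝ))⁻¹) ι e (fun _ _ => (1 : Matrix mm mm ℂ)) (fun μ x' => NormedSpace.exp (((((L ^ i.r * L ^ i.kk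 : ℕ) : ℝ))⁻¹) • A' μ x')) (cvNL' d L i.m i.kk i.r hL a ι) (fun _ => 0))) ((covLapM (bshiftEquiv (cvM d L i.m i.kk hL) (L ^ i.kk)) ((((L ^ i.kk : ℕ) : ℝ))⁻¹) (gaugePair (bshiftEquiv (cvM d L i.m i.kk hL) (L ^ i.kk)) (fun μ x => coordMat e (ContinuousLinearMap.mulLeftRight ℝ (Matrix mm mm ℂ) (NormedSpace.exp (((((L ^ i.kk : ℕ) : ℝ))⁻¹) • gavgM (Matrix mm mm ℂ) (Fin (d + 1)) (kingPrV L i.kk i.r (cvM d L i.m i.kk hL)) A' μ x)) (NormedSpace.exp (((((L ^ i.kk : ℕ) : ℝ))⁻¹) • gavgM (Matrix mm mm ℂ) (Fin (d + 1)) (kingPrV L i.kk i.r (cvM d L i.m i.kk hL)) A' μ x))ᴴ)))) ∘ₗ (cvGlued d L i.m i.kk hL a ((((L ^ i.kk : ℕ) : ℝ))⁻¹) ι e (fun _ _ => (1 : Matrix mm mm ℂ)) (fun μ x => NormedSpace.exp (((((L ^ i.kk : ℕ) : ℝ))⁻¹) • gavgM (Matrix mm mm ℂ) (Fin (d + 1))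 (kingPrV L i.kk i.r (cvM d L i.m i.kk hL)) A' μ x)) (cvNL d L i.m i.kk hL a ι) (fun _ => 0))))
    (hE : ∃ M₁ δ₁ a₁ B₁ γ₁ : ℝ, 0 < M₁ ∧ 0 < δ₁ ∧ 0 < a₁ ∧ 0 < B₁ ∧ 0 < γ₁ ∧
      ∀ i : SfIdx d L, M₁ ≤ (L : ℝ) ^ i.m → ∀ α₀ : ℝ, 0 < α₀ → (L : ℝ) ^ i.m * α₀ ≤ a₁ →
        ∀ A' : Fin (d + 1) → CvX' d L i.m i.kk i.r hL → Matrix mm mm ℂ, (sfInstance d mm ι hL i).Bf.Reg335 c35 α₀ A' → ∀ n : Fin 4, n ≠ 0 → n ≠ 3 →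
          HasMaj (BlockNorm.ofBlocks (sfGeo d hL i) (liftBlk (cvBlk d L i.m i.kk hL) ι))
            (BlockNorm.ofBlocks (sfGeo d hL i) (liftBlk (cvBlk d L i.m i.kk hL ∘ kingPrV L i.kk i.r (cvM d L i.m i.kk hL)) ι)) (E i n A')
            (fun y y' => B₁ * B9.pref4 ((opGeo (sfGeo d hL i) (CvX d L i.m i.kk hL × ι) (liftBlk (cvBlk d L i.m i.kk hL) ι)).len y) n * Real.exp (-(δ₁ * (sfGeo d hL i).dist y y')) *
              max (rateFactor (opGeo (sfGeo d hL i) (CvX d L i.m i.kk hL × ι) (liftBlk (cvBlk d L i.m i.kk hL) ι)) γ₁ y)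
                (rateFactor (opGeo (sfGeo d hL i) (CvX d L i.m i.kk hL × ι) (liftBlk (cvBlk d L i.m i.kk hL) ι)) γ₁ y'))) :
    NE2PlusOperator c35 (sfInstance d mm ι hL) (fun i => sfFamily d mm ι a e hL i (E i)) := by
  obtain ⟨ρ, w₃, R₃, D₃, hρ, hR₃, hD₃, H3⟩ := sf_idef_lap_cvGlued (d := d) hL hL7 ha ι
  obtain ⟨M₁, δ₁, a₁, B₁, γ₁, hM₁, hδ₁, ha₁, hB₁, hγ₁, hE⟩ := hE
  have hLpos : 0 < L := Nat.pos_of_ne_zero (NeZero.ne L)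
  have hLr : (0 : ℝ) < (L : ℝ) := Nat.cast_pos.mpr hLpos
  have hL1 : (1 : ℝ) ≤ (L : ℝ) := by exact_mod_cast hLpos
  have hκ0 : 0 ≤ basisConst e := basisConst_nonneg e
  -- the window constants for entry 3 (as for entry 0 in FILE 132)
  let σ : ℝ := 14 * Real.exp 1 * (1 + Fintype.card (Fin (d + 1))) * basisConst e * ((1 + Fintype.card (Fin (d + 1))) * (3 + 2 * ((d : ℝ) + 1)))
  have hσ0 : 0 ≤ σ := by positivity
  let JJ : ℝ := 1 + Fintype.card (Fin (d + 1) ⊕ Fin (d + 1))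
  have hJJ0 : 0 ≤ JJ := by positivity
  let W : ℝ := 2 * ((1 + Fintype.card (Fin (d + 1))) * (3 + 2 * ((d : ℝ) + 1)))
  have hW0 : 0 < W := by positivity
  let aW : ℝ := 1 / (W * c35)
  have haW : 0 < aW := by positivity
  let aR : ℝ := R₃ / (σ * c35 * JJ + 1)
  have haR : 0 < aR := by positivity
  let a₀ : ℝ := min a₁ (min aW aR)
  have ha₀ : 0 < a₀ := lt_min ha₁ (lt_min haW haR)
  have ha₀a₁ : a₀ ≤ a₁ := min_le_left _ _
  have ha₀W : a₀ ≤ aW := (min_le_right _ _).trans (min_le_left _ _)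
  have ha₀R : a₀ ≤ aR := (min_le_right _ _).trans (min_le_right _ _)
  let M₀ : ℝ := max (max w₃ M₁) 1
  have hM₀ : 0 < M₀ := lt_of_lt_of_le one_pos (le_max_right _ _)
  let δ₀ : ℝ := min ρ δ₁
  have hδ₀ : 0 < δ₀ := lt_min hρ hδ₁
  let γ : ℝ := min (1 / 16 : ℝ) γ₁
  have hγ : 0 < γ := lt_min (by norm_num) hγ₁
  let B₀ : ℝ := D₃ * (1 + σ * (c35 * a₀) * JJ) + B₁
  have hB₀ : 0 < B₀ := add_pos_of_nonneg_of_pos (by positivity) hB₁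
  refine ne2PlusOperator_sf d mm ι e hL hL7 ha hc35 he E ⟨M₀, δ₀, a₀, B₀, γ, hM₀, hδ₀, ha₀, hB₀, hγ, fun i hM α₀ hα₀ hMa A' hA' n hn => ?_⟩
  have hw₃ : w₃ ≤ ((L ^ i.m : ℕ) : ℝ) := by push_cast; exact ((le_max_left _ _).trans (le_max_left _ _)).trans hM
  have hM₁' : M₁ ≤ (L : ℝ) ^ i.m := ((le_max_right _ _).trans (le_max_left _ _)).trans hM
  have hMa₁ : (L : ℝ) ^ i.m * α₀ ≤ a₁ := hMa.trans ha₀a₁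
  have hx1 : (1 : ℝ) ≤ (L : ℝ) ^ i.kk := one_le_pow₀ hL1
  have hxpos : (0 : ℝ) < (L : ℝ) ^ i.kk := pow_pos hLr _
  have hcast : (((L ^ i.kk : ℕ) : ℝ)) = (L : ℝ) ^ i.kk := by push_cast; rfl
  have hrf : ∀ y : (sfGeo d hL i).Site, ∀ γ' : ℝ, rateFactor (opGeo (sfGeo d hL i) (CvX d L i.m i.kk hL × ι) (liftBlk (cvBlk d L i.m i.kk hL) ι)) γ' y = ((L : ℝ) ^ i.kk) ^ (-γ') :=
    fun y γ' => sfGeo_rateFactor d hL i _ γ' y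
  have hrfγ : ((L : ℝ) ^ i.kk) ^ (-(1 / 16 : ℝ)) ≤ ((L : ℝ) ^ i.kk) ^ (-γ) := Real.rpow_le_rpow_of_exponent_le hx1 (by linarith [min_le_left (1 / 16 : ℝ) γ₁])
  have hrfγ₁ : ((L : ℝ) ^ i.kk) ^ (-γ₁) ≤ ((L : ℝ) ^ i.kk) ^ (-γ) := Real.rpow_le_rpow_of_exponent_le hx1 (by linarith [min_le_right (1 / 16 : ℝ) γ₁])
  have hinv : ((L : ℝ) ^ i.kk)⁻¹ ≤ ((L : ℝ) ^ i.kk) ^ (-(1 / 16 : ℝ)) := by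
    rw [← Real.rpow_neg_one]
    exact Real.rpow_le_rpow_of_exponent_le hx1 (by norm_num)
  have hδ₀ρ : δ₀ ≤ ρ := min_le_left _ _
  have hδ₀₁ : δ₀ ≤ δ₁ := min_le_right _ _
  by_cases h3 : n = 3
  · -- ENTRY 3: FILE 134
    subst h3
    rw [hE3]
    obtain ⟨hskew, h1, h2, h3l⟩ := (sfInstance_reg335_iff d mm ι hL i c35 α₀ A').1 hA'
    have hconv : ((L : ℝ) ^ i.kk)⁻¹ * ((L : ℝ) ^ i.r)⁻¹ = (((L ^ i.r * L ^ i.kk : ℕ) : ℝ))⁻¹ := by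
      push_cast
      rw [mul_inv, mul_comm]
    have hrA0 : 0 ≤ c35 * (L : ℝ) ^ i.m * α₀ := by positivity
    have hrAa : c35 * (L : ℝ) ^ i.m * α₀ ≤ c35 * a₀ := by
      rw [mul_assoc]; exact mul_le_mul_of_nonneg_left hMa hc35.le
    have h2' : ∀ μ κ x', ‖A' μ (bshiftEquiv (cvM d L i.m i.kk hL) (L ^ i.r * L ^ i.kk) κ x') - A' μ x'‖ ≤ c35 * (L : ℝ) ^ i.m * α₀ * ((((L ^ i.r * L ^ i.kk : ℕ) : ℝ))⁻¹) :=
      fun μ κ x' => (h2 μ κ x').trans_eq (by rw [hconv])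
    have h3' : ∀ μ κ x', ‖(A' μ (bshiftEquiv (cvM d L i.m i.kk hL) (L ^ i.r * L ^ i.kk) κ x') - A' μ x') -
        (A' μ (bshiftEquiv (cvM d L i.m i.kk hL) (L ^ i.r * L ^ i.kk) κ ((bshiftEquiv (cvM d L i.m i.kk hL) (L ^ i.r * L ^ i.kk) μ).symm x')) -
          A' μ ((bshiftEquiv (cvM d L i.m i.kk hL) (L ^ i.r * L ^ i.kk) μ).symm x'))‖ ≤
        c35 * (L : ℝ) ^ i.m * α₀ * ((((L ^ i.r * L ^ i.kk : ℕ) : ℝ))⁻¹) * ((((L ^ i.r * L ^ i.kk : ℕ) : ℝ))⁻¹) :=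
      fun μ κ x' => (h3l μ κ x').trans_eq (by rw [hconv])
    have hr2 : 2 * ((1 + Fintype.card (Fin (d + 1))) * ((3 + 2 * ((d : ℝ) + 1)) * (c35 * (L : ℝ) ^ i.m * α₀))) ≤ 1 := by
      have hWa : W * (c35 * a₀) ≤ 1 := by
        calc W * (c35 * a₀) ≤ W * (c35 * aW) := mul_le_mul_of_nonneg_left (mul_le_mul_of_nonneg_left ha₀W hc35.le) hW0.le
          _ = 1 := by
            show W * (c35 * (1 / (W * c35))) = 1
            field_simp
      calc 2 * ((1 + Fintype.card (Fin (d + 1))) * ((3 + 2 * ((d : ℝ) + 1)) * (c35 * (L : ℝ) ^ i.m * α₀))) = W * (c35 * (L : ℝ) ^ i.m * α₀) := by ring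
        _ ≤ W * (c35 * a₀) := mul_le_mul_of_nonneg_left hrAa hW0.le
        _ ≤ 1 := hWa
    have hscale : 14 * Real.exp 1 * (1 + Fintype.card (Fin (d + 1))) * basisConst e * ((1 + Fintype.card (Fin (d + 1))) * ((3 + 2 * ((d : ℝ) + 1)) * (c35 * (L : ℝ) ^ i.m * α₀))) =
        σ * (c35 * (L : ℝ) ^ i.m * α₀) := by ring
    have hSle : σ * (c35 * (L : ℝ) ^ i.m * α₀) ≤ σ * (c35 * a₀) := mul_le_mul_of_nonneg_left hrAa hσ0
    have hRle : 14 * Real.exp 1 * (1 + Fintype.card (Fin (d + 1))) * basisConst e * ((1 + Fintype.card (Fin (d + 1))) * ((3 + 2 * ((d : ℝ) + 1)) * (c35 * (L : ℝ) ^ i.m * α₀))) *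
        (1 + Fintype.card (Fin (d + 1) ⊕ Fin (d + 1))) ≤ R₃ := by
      rw [hscale]
      have hRa : σ * (c35 * aR) * JJ ≤ R₃ := by
        have hden : 0 < σ * c35 * JJ + 1 := by positivity
        calc σ * (c35 * aR) * JJ = R₃ * (σ * c35 * JJ) / (σ * c35 * JJ + 1) := by
              show σ * (c35 * (R₃ / (σ * c35 * JJ + 1))) * JJ = R₃ * (σ * c35 * JJ) / (σ * c35 * JJ + 1)
              field_simp
          _ ≤ R₃ * (σ * c35 * JJ + 1) / (σ * c35 * JJ + 1) := by gcongr; linarith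
          _ = R₃ := by field_simp
      calc σ * (c35 * (L : ℝ) ^ i.m * α₀) * JJ ≤ σ * (c35 * a₀) * JJ := mul_le_mul_of_nonneg_right hSle hJJ0
        _ ≤ σ * (c35 * aR) * JJ := mul_le_mul_of_nonneg_right (mul_le_mul_of_nonneg_left (mul_le_mul_of_nonneg_left ha₀R hc35.le) hσ0) hJJ0
        _ ≤ R₃ := hRa
    have key := hasMaj_unitTorusGeoS (d := d) (L := L) ((L : ℝ) ^ i.m) (H3 i.m i.kk i.r i.one_le hw₃ e he A' hskew (c35 * (L : ℝ) ^ i.m * α₀) hrA0 h1 h2' h3' hr2 hRle)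
    refine key.mono fun y y' => ?_
    rw [opGeo_len, sfGeo_len d hL i y, hrf y γ, hrf y' γ, max_self, hcast]
    have hpref : B9.pref4 (1 : ℝ) 3 = 1 := by simp [B9.pref4]
    rw [hpref, mul_one]
    have hd0 : 0 ≤ (sfGeo d hL i).dist y y' := sfGeo_dist_nonneg d hL i y y'
    have hexp : Real.exp (-(ρ * (unitTorusGeo L i.kk (cvM d L i.m i.kk hL)).dist y y')) ≤ Real.exp (-(δ₀ * (sfGeo d hL i).dist y y')) := by
      refine Real.exp_le_exp.mpr (neg_le_neg ?_)
      exact mul_le_mul_of_nonneg_right hδ₀ρ hd0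
    have hE0 : 0 ≤ Real.exp (-(ρ * (unitTorusGeo L i.kk (cvM d L i.m i.kk hL)).dist y y')) := Real.exp_nonneg _
    have hbr : ((L : ℝ) ^ i.kk) ^ (-(1 / 16 : ℝ)) + σ * (c35 * (L : ℝ) ^ i.m * α₀) * (1 + Fintype.card (Fin (d + 1) ⊕ Fin (d + 1))) * ((L : ℝ) ^ i.kk)⁻¹ ≤
        (1 + σ * (c35 * a₀) * JJ) * ((L : ℝ) ^ i.kk) ^ (-γ) := by
      have hA : ((L : ℝ) ^ i.kk) ^ (-(1 / 16 : ℝ)) ≤ ((L : ℝ) ^ i.kk) ^ (-γ) := hrfγ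
      have hB : σ * (c35 * (L : ℝ) ^ i.m * α₀) * (1 + Fintype.card (Fin (d + 1) ⊕ Fin (d + 1))) * ((L : ℝ) ^ i.kk)⁻¹ ≤ σ * (c35 * a₀) * JJ * ((L : ℝ) ^ i.kk) ^ (-γ) :=
        mul_le_mul (mul_le_mul_of_nonneg_right hSle hJJ0) (hinv.trans hrfγ) (by positivity) (by positivity)
      nlinarith [hA, hB]
    have hrpos : 0 ≤ ((L : ℝ) ^ i.kk) ^ (-γ) := Real.rpow_nonneg hxpos.le _
    calc D₃ * (((L : ℝ) ^ i.kk) ^ (-(1 / 16 : ℝ)) + 14 * Real.exp 1 * (1 + Fintype.card (Fin (d + 1))) * basisConst e * ((1 + Fintype.card (Fin (d + 1))) *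
            ((3 + 2 * ((d : ℝ) + 1)) * (c35 * (L : ℝ) ^ i.m * α₀))) * (1 + Fintype.card (Fin (d + 1) ⊕ Fin (d + 1))) * ((L : ℝ) ^ i.kk)⁻¹) *
          Real.exp (-(ρ * (unitTorusGeo L i.kk (cvM d L i.m i.kk hL)).dist y y'))
        ≤ D₃ * ((1 + σ * (c35 * a₀) * JJ) * ((L : ℝ) ^ i.kk) ^ (-γ)) * Real.exp (-(ρ * (unitTorusGeo L i.kk (cvM d L i.m i.kk hL)).dist y y')) := by
          rw [hscale]
          exact mul_le_mul_of_nonneg_right (mul_le_mul_of_nonneg_left hbr hD₃) hE0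
      _ ≤ D₃ * ((1 + σ * (c35 * a₀) * JJ) * ((L : ℝ) ^ i.kk) ^ (-γ)) * Real.exp (-(δ₀ * (sfGeo d hL i).dist y y')) :=
          mul_le_mul_of_nonneg_left hexp (by positivity)
      _ = (D₃ * (1 + σ * (c35 * a₀) * JJ)) * Real.exp (-(δ₀ * (sfGeo d hL i).dist y y')) * ((L : ℝ) ^ i.kk) ^ (-γ) := by ring
      _ ≤ B₀ * Real.exp (-(δ₀ * (sfGeo d hL i).dist y y')) * ((L : ℝ) ^ i.kk) ^ (-γ) := by
          refine mul_le_mul_of_nonneg_right (mul_le_mul_of_nonneg_right ?_ (Real.exp_nonneg _)) hrpos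
          show D₃ * (1 + σ * (c35 * a₀) * JJ) ≤ D₃ * (1 + σ * (c35 * a₀) * JJ) + B₁
          linarith
  · -- ENTRIES 1–2: the displayed gradient rows, weakened to the merged constants
    refine (hE i hM₁' α₀ hα₀ hMa₁ A' hA' n hn h3).mono fun y y' => ?_
    rw [opGeo_len, sfGeo_len d hL i y, hrf y γ, hrf y' γ, hrf y γ₁, hrf y' γ₁, max_self, max_self]
    have hp0 : 0 ≤ B9.pref4 (1 : ℝ) n := (pref4_pos one_pos n).le
    have hd0 : 0 ≤ (sfGeo d hL i).dist y y' := sfGeo_dist_nonneg d hL i y y'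
    have hexp : Real.exp (-(δ₁ * (sfGeo d hL i).dist y y')) ≤ Real.exp (-(δ₀ * (sfGeo d hL i).dist y y')) :=
      Real.exp_le_exp.mpr (neg_le_neg (mul_le_mul_of_nonneg_right hδ₀₁ hd0))
    have hBB : B₁ ≤ B₀ := by
      show B₁ ≤ D₃ * (1 + σ * (c35 * a₀) * JJ) + B₁
      have : 0 ≤ D₃ * (1 + σ * (c35 * a₀) * JJ) := by positivity
      linarith
    exact mul_le_mul (mul_le_mul (mul_le_mul_of_nonneg_right hBB hp0) hexp (Real.exp_nonneg _) (by positivity)) hrfγ₁ (Real.rpow_nonneg hxpos.le _) (by positivity)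

end Summit.QuantumFields.YangMills.BalabanUVNodes.N15.Gluing

end
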